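import Summits.Ventures.HodgeKum4.Theses.KummerFixedLocus
import Summits.Ventures.HodgeKum4.Theorems.KummerFixedLocusPointCount
import HarnessLib

/-!
# Route items L2 / L2′ (conditional closers) and the rung-leaf-keyed H3 statements
(cell `hodge-kum4`, seat p2)

HONEST FRAMING.  Nothing here proves the Hodge conjecture for `Kum⁴`-type varieties; every theorem
is CONDITIONAL on REFEREED printed facts taken as hypotheses and on route nodes by name.
* `motivicBookkeepingKum4_route_of_facts`, `invariantHodgeClassesAlgebraicKum4_route_of_facts`: the
  route items L2 (stmt-Ventures-19136) and L2′ (stmt-Ventures-19160) with their ROUTE decls as types,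
  from four printed facts (O'Grady–Markman–Voisin `J³`, Floccari–Fu, Foster `B(X)`, André guarded)
  and the nodes F_Γ, F_Γ′, L3° (and L1 for L2′) — the director's helper chain
  `motivicBookkeepingKum4_of_dominated_of_fixedLocus ∘ gammaInvariantsDominatedKum4_of_facts`.
* `hc_kum4Type_of_facts_of_nodes'`, `hc_kum4Type_of_L1_of_meetsTranslates'`,
  `hc_kum4Type_of_L1_of_pointCount'`: the composed H3 statements with conclusion EXACTLY the rung
  leaf `Summit.Ventures.HodgeKum4.HC_Kum4Type` (planner g6 ask (d)), the last one through the
  booked residual `Kum4FixedPointCountAtKummer` (B″) and thirteen printed statements.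
-/

noncomputable section

open Literature.AlgebraicGeometry Literature.AlgebraicGeometry.HodgeTheory
open Literature.AlgebraicGeometry.Hyperkaehler

namespace Summit.Ventures.HodgeKum4

/-- **Route item L2 (`MotivicBookkeepingKum4`), conditional on print**: from four REFEREED facts
(O'Grady–Markman–Voisin `J³`, Floccari–Fu, Foster `B(X)`, André guarded) and the route nodes F_Γ,
F_Γ′, L3° — the director's helper chain `motivicBookkeepingKum4_of_dominated_of_fixedLocus ∘
gammaInvariantsDominatedKum4_of_facts`, stated with the route decl as its type. -/
theorem motivicBookkeepingKum4_route_of_facts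
    (hOGV : OGradyVoisin2022_thirdJacobian_kugaSatake_kummerType)
    (hFF : FloccariFu2026_hodgeClasses_algebraic_powers_discOneWeilFourfold)
    (hFo : Foster2024_lefschetzStandard_kummerType_prime)
    (hAn : Andre1996_dualLefschetz_mem_adjoin_lefschetzInvolution)
    (hΓ : Kum4TranslationGroup) (hoff : Kum4TranslationGroupTrivialOffMiddle)
    (h₃ : Kum4NonInvariantClassesAlgebraic) :
    Summit.Ventures.HodgeKum4.Theses.KummerFixedLocus.MotivicBookkeepingKum4 := by
  unfold Summit.Ventures.HodgeKum4.Theses.KummerFixedLocus.MotivicBookkeepingKum4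
  exact motivicBookkeepingKum4_of_facts_of_fixedLocus hOGV hFF hFo hAn hΓ hoff h₃

/-- **Route item L2′ (`InvariantHodgeClassesAlgebraicKum4`, support by name), conditional on print**:
modus ponens of L2 (previous theorem) with L1. -/
theorem invariantHodgeClassesAlgebraicKum4_route_of_facts
    (hOGV : OGradyVoisin2022_thirdJacobian_kugaSatake_kummerType)
    (hFF : FloccariFu2026_hodgeClasses_algebraic_powers_discOneWeilFourfold)
    (hFo : Foster2024_lefschetzStandard_kummerType_prime)
    (hAn : Andre1996_dualLefschetz_mem_adjoin_lefschetzInvolution)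
    (hΓ : Kum4TranslationGroup) (hoff : Kum4TranslationGroupTrivialOffMiddle)
    (h₃ : Kum4NonInvariantClassesAlgebraic) (h₁ : LefschetzGenerationKum4) :
    Summit.Ventures.HodgeKum4.Theses.KummerFixedLocus.InvariantHodgeClassesAlgebraicKum4 := by
  unfold Summit.Ventures.HodgeKum4.Theses.KummerFixedLocus.InvariantHodgeClassesAlgebraicKum4
  exact motivicBookkeepingKum4_of_facts_of_fixedLocus hOGV hFF hFo hAn hΓ hoff h₃ h₁

/-- **H3 (the rung leaf exactly) from four printed facts and the route nodes L1, F_Γ, F_Γ′, L3°** —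
`hc_kum4Type_of_facts_of_nodes` with conclusion `Summit.Ventures.HodgeKum4.HC_Kum4Type`. -/
theorem hc_kum4Type_of_facts_of_nodes'
    (hOGV : OGradyVoisin2022_thirdJacobian_kugaSatake_kummerType)
    (hFF : FloccariFu2026_hodgeClasses_algebraic_powers_discOneWeilFourfold)
    (hFo : Foster2024_lefschetzStandard_kummerType_prime)
    (hAn : Andre1996_dualLefschetz_mem_adjoin_lefschetzInvolution)
    (h₁ : LefschetzGenerationKum4) (hΓ : Kum4TranslationGroup) (hoff : Kum4TranslationGroupTrivialOffMiddle)
    (h₃ : Kum4NonInvariantClassesAlgebraic) :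
    Summit.Ventures.HodgeKum4.HC_Kum4Type :=
  (hc_kum4Type_of_facts_of_nodes hOGV hFF hFo hAn h₁ hΓ hoff h₃).1

/-- **H3 (the rung leaf exactly) modulo L1, I1geo and print** — `hc_kum4Type_of_L1_of_meetsTranslates`
with conclusion `Summit.Ventures.HodgeKum4.HC_Kum4Type`: eleven REFEREED named facts (hypotheses),
the cell lemma L1 and the geometric residual I1geo. -/
theorem hc_kum4Type_of_L1_of_meetsTranslates'
    (hOGV : OGradyVoisin2022_thirdJacobian_kugaSatake_kummerType)
    (hFF : FloccariFu2026_hodgeClasses_algebraic_powers_discOneWeilFourfold)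
    (hFo : Foster2024_lefschetzStandard_kummerType_prime)
    (hAn : Andre1996_dualLefschetz_mem_adjoin_lefschetzInvolution)
    (hA1 : Hirzebruch1969_gSignature_involution_halfDimFixedLocus)
    (hA2 : Floccari2026_fixedFourfold_kum4Type)
    (hHIR : Voisin2002_hodgeIndex_hodgeRiemann_middle)
    (hGS : GoettscheSoergel1993_chiY_kum4Type)
    (hGK : GreenKimLazaRobles2022_llvTrivial_isOfHodgeType_kumType)
    (hF : Foster2024_translationAction_kum4Type)
    (hcardF : Floccari2026_card_autFixingH2H3_kum4Type)
    (hFu : Fulton1998_cupPairing_transversalPoint)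
    (hL1 : LefschetzGenerationKum4) (hgeo : Kum4FixedFourfoldMeetsTranslates) :
    Summit.Ventures.HodgeKum4.HC_Kum4Type :=
  (hc_kum4Type_of_L1_of_meetsTranslates hOGV hFF hFo hAn hA1 hA2 hHIR hGS hGK hF hcardF hFu hL1 hgeo).1

/-- **H3 (the rung leaf exactly) from thirteen printed statements, L1 and the booked residual — the
point count at the Kummer varieties** (`hc_kum4Type_of_L1_of_pointCount`, first component). -/
theorem hc_kum4Type_of_L1_of_pointCount'
    (hOGV : OGradyVoisin2022_thirdJacobian_kugaSatake_kummerType)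
    (hFF : FloccariFu2026_hodgeClasses_algebraic_powers_discOneWeilFourfold)
    (hFo : Foster2024_lefschetzStandard_kummerType_prime)
    (hAn : Andre1996_dualLefschetz_mem_adjoin_lefschetzInvolution)
    (hA1 : Hirzebruch1969_gSignature_involution_halfDimFixedLocus)
    (hA2 : Floccari2026_fixedFourfold_kum4Type)
    (hHIR : Voisin2002_hodgeIndex_hodgeRiemann_middle)
    (hGS : GoettscheSoergel1993_chiY_kum4Type)
    (hGK : GreenKimLazaRobles2022_llvTrivial_isOfHodgeType_kumType)
    (hF : Foster2024_translationAction_kum4Type)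
    (hcardF : Floccari2026_card_autFixingH2H3_kum4Type)
    (hFu : Fulton1998_cupPairing_transversalPoint)
    (hT : HassettTschinkel2013_Floccari2026_fixedFourfoldClass_transport_kum4Type)
    (hOg : Oguiso2020_fixedPointScheme_translation_generalizedKummerFour)
    (hL1 : LefschetzGenerationKum4) (hc : Kum4FixedPointCountAtKummer) :
    Summit.Ventures.HodgeKum4.HC_Kum4Type :=
  (hc_kum4Type_of_L1_of_pointCount hOGV hFF hFo hAn hA1 hA2 hHIR hGS hGK hF hcardF hFu hT hOg hL1 hc).1

end Summit.Ventures.HodgeKum4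

end
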